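import Summits.HubbardSuperconductivity.HubbardSuperconductivity.Theorems.BalabanIRBirComplexStableXYStiffnessHolomorphy
import Summits.HubbardSuperconductivity.HubbardSuperconductivity.Theorems.BalabanIRBirComplexStableXYStiffnessAdmissible
import Summits.HubbardSuperconductivity.HubbardSuperconductivity.Theorems.BalabanIRBirComplexStableXYHolomorphicTwoLevelZero

/-!
# Negative lemma for `BalabanIR.BirComplexStableXY` (stmt-HubbardSuperconductivity-2080) modulo `StiffTwoLevelStructure`

Line `theta-rotor-equimodular-zeros` (line lead prover-line-stmt-HubbardSuperconductivity-2080-0, 2026-08-16): the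
Beraha–Kahane–Weiss refutation of the typed crux, CLOSED MODULO ITS SPECTRAL HEART, in the holomorphic stiffness
coordinate (crux idea `holomorphic-stiffness-hurwitz`).  The admissible family is the stiffness table
`c(a, ε₂) = spatialTab + a • temporalCosTab + (iε₂) • temporalSinTab` (real unit spatial XY, COMPLEX temporal stiffness `a`,
Berry-like term `iε₂ sin ∂_τθ`; at `a = 1 + iε₁` it is the sibling files' `witness ε₁ ε₂`), admissible for the crux's four
hypotheses with `r = 2`, `B = 128`, `c₀ = 1/24` on `‖a − 1‖ ≤ 1/4`, `|ε₂| ≤ 1/5` (landed stub `stub_stiffTab_admissible`).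
Its partition function `Z = partZ K (c(a, ε₂)) L M` is ENTIRE in `a` (landed stub `stub_partZ_stiff_differentiable`), and by
the HOLOMORPHIC two-level zero lemma (landed stub `stub_holomorphicTwoLevelZeroLemma`: if `f_M = 1 + u^M + O(q^M)` uniformly on a
disc with `u` holomorphic, non-constant, `‖u a₀‖ = 1`, then `f_M` has a zero in the disc for every large `M` — M-th roots of
`−1`, `v_M = u·(1 + R_M u^{−M})^{1/M} → u`, and Hurwitz's theorem `Literature…Complex.Hurwitz`) zeros of `Z` follow from the
purely SPECTRAL hypothesis `StiffTwoLevelStructure`: the BKW two-level normal form `Z_M(a)/lam(a)^M = 1 + u(a)^M + O(q^M)` on a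
disc around a modulus-tie point `a₀` (`u` = ratio of the two dominant charge-sector eigenvalues of the slice transfer operator,
holomorphic in `a` and NON-CONSTANT — no Jacobian condition; `lam` = the dominant eigenvalue; `q < 1` = spectral gap), at some
`K ≥ K₀`, `L ≥ L₀`, `|ε₂| ≤ 1/5` for every `K₀, L₀`.  Hence
`BirComplexStableXY_false_of_StiffTwoLevelStructure : StiffTwoLevelStructure → ¬ BirComplexStableXY`.
Why the holomorphic coordinate: coercivity (C) constrains only `Re a`, so `a` ranges over an open complex disc INSIDE the
admissible class; the earlier `(ε₁, ε₂)`-plane version of the heart needed an invertible real Jacobian of the eigenvalue ratio,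
an `O(1/κ²)` anharmonic quantity ((C) forces the flux to be real, so at Gaussian order equimodular sector tops have equal
phase), whereas here non-constancy of a holomorphic function suffices and the tie point can be taken at REAL stiffness
(positive self-adjoint transfer operator; one real equation in `ε₂`, intermediate value theorem).
What H still needs (not constructible in the tree today; numerically certified on the item's evidence at L = 1, 2 — jobs
j004976, j014041–3): the charge-sector trace formula for the slice transfer operator on `L²(𝕋^{L²})` (trace class, sectors,
gauge identity `partZ_witness_gauge` of Theorems/BalabanIRBirComplexStableXYGaugeIdentity), simplicity of the sector-`0` and
sector-`±1` tops and the ordering `μ₀ > μ₁ > sup(rest)` for real stiffness at arbitrary `L` (Jentzsch / Perron–Frobenius per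
sector, rotor gap), Kato holomorphy of the two simple tops in `a`, and persistence of the gap (the geometric `O(q^M)` tail).
None has Mathlib support today (no Jentzsch, no isolated-eigenvalue perturbation theory, no trace asymptotics), but all are
standard functional analysis on paper.  REPAIR for the planner (unchanged, all seats): restate the crux with time-reflection
Hermiticity of the table, `(∀ n, c (fun w => n (w.1, w.2.1, Fin.rev w.2.2)) = (starRingEnd ℂ) (c (-n))) →` after (C)
(+ `Even M`), and 2082 := C′ → target in the same edit.
-/

namespace Summit.HubbardSuperconductivity.BirComplexStableXYNegative

open scoped BigOperators
open MeasureTheory Metric Literature.Probability.LatticeModels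

noncomputable section

/-- HYPOTHESIS H — the Beraha–Kahane–Weiss TWO-LEVEL STRUCTURE in the holomorphic stiffness coordinate (the spectral heart
of the refutation): for every `K₀, L₀` there are `K ≥ K₀`, `L ≥ L₀`, a Berry parameter `|ε₂| ≤ 1/5`, a stiffness `a₀` with a
closed disc inside the admissible disc `‖a − 1‖ ≤ 1/4`, constants `C`, `0 ≤ q < 1`, a holomorphic NON-CONSTANT `u` on the
open disc with `‖u a₀‖ = 1` (modulus tie of the two dominant charge sectors) and a holomorphic non-vanishing normaliser `lam`
(the dominant eigenvalue branch) with `‖Z_M(a)/lam(a)^M − 1 − u(a)^M‖ ≤ C q^M` on the disc for all large `M`. -/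
def StiffTwoLevelStructure : Prop :=
    ∀ (K₀ : ℝ) (L₀ : ℕ), ∃ K : ℝ, K₀ ≤ K ∧ ∃ (L : ℕ) (_ : NeZero L), L₀ ≤ L ∧
      ∃ ε₂ : ℝ, |ε₂| ≤ 1/5 ∧
      ∃ (a₀ : ℂ) (ρ C q : ℝ), 0 < ρ ∧ 0 ≤ q ∧ q < 1 ∧ closedBall a₀ ρ ⊆ closedBall (1 : ℂ) (1/4) ∧
        ∃ u lam : ℂ → ℂ, DifferentiableOn ℂ u (ball a₀ ρ) ∧ ‖u a₀‖ = 1 ∧ (∃ a ∈ ball a₀ ρ, u a ≠ u a₀) ∧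
          DifferentiableOn ℂ lam (ball a₀ ρ) ∧ (∀ a ∈ ball a₀ ρ, lam a ≠ 0) ∧
          ∃ M₁ : ℕ, ∀ M : ℕ, M₁ ≤ M → ∀ (_ : NeZero M), ∀ a ∈ ball a₀ ρ,
            ‖partZ K (spatialTab + a • temporalCosTab + (Complex.I * ε₂) • temporalSinTab) L M / (lam a) ^ M
                - 1 - (u a) ^ M‖ ≤ C * q ^ M

/-- ZEROS FROM H (sorry-free): the two-level structure forces, for every `K₀, L₀`, a zero of `Z` at some `K ≥ K₀`,
`L₀ ≤ L ≤ M`, for an admissible-disc stiffness `‖a − 1‖ ≤ 1/4` and `|ε₂| ≤ 1/5`.  Proof: normalise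
`f M a = Z_M(a)/lam(a)^M` (junk value `1` at `M = 0`), holomorphic on the disc by `stub_partZ_stiff_differentiable`; apply
`stub_holomorphicTwoLevelZeroLemma`; un-normalise (`lam ≠ 0`). -/
theorem stiffZeroExists_of_stiffTwoLevelStructure (h2 : StiffTwoLevelStructure) :
    ∀ (K₀ : ℝ) (L₀ : ℕ), ∃ K : ℝ, K₀ ≤ K ∧ ∃ (a : ℂ) (ε₂ : ℝ), ‖a - 1‖ ≤ 1/4 ∧ |ε₂| ≤ 1/5 ∧
      ∃ (L M : ℕ) (_ : NeZero L) (_ : NeZero M), L₀ ≤ L ∧ L ≤ M ∧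
        partZ K (spatialTab + a • temporalCosTab + (Complex.I * ε₂) • temporalSinTab) L M = 0 := by
  intro K₀ L₀
  obtain ⟨K, hK, L, hL, hL₀, ε₂, hε₂, a₀, ρ, C, q, hρ, hq0, hq1, hdisc, u, lam, hu, hnorm, hnc, hlam, hlam0, M₁, happrox⟩ :=
    h2 K₀ L₀
  -- the normalised family, junk value 1 at M = 0
  set f : ℕ → ℂ → ℂ := fun M a =>
    if h : M = 0 then 1 else
      (haveI : NeZero M := ⟨h⟩;
        partZ K (spatialTab + a • temporalCosTab + (Complex.I * ε₂) • temporalSinTab) L M / (lam a) ^ M) with hf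
  have hfM : ∀ (M : ℕ) [hM : NeZero M] (a : ℂ),
      f M a = partZ K (spatialTab + a • temporalCosTab + (Complex.I * ε₂) • temporalSinTab) L M / (lam a) ^ M := by
    intro M hM a
    simp only [hf, dif_neg hM.ne]
  -- holomorphy of the normalised family on the disc
  have hdiff : ∀ M : ℕ, DifferentiableOn ℂ (f M) (ball a₀ ρ) := by
    intro M
    by_cases hM : M = 0
    · subst hM
      have h0 : f 0 = fun _ => 1 := by
        funext a
        simp [hf]
      rw [h0]
      exact differentiableOn_const 1
    · haveI : NeZero M := ⟨hM⟩
      have h1 : DifferentiableOn ℂ (fun a : ℂ =>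
          partZ K (spatialTab + a • temporalCosTab + (Complex.I * ε₂) • temporalSinTab) L M) (ball a₀ ρ) :=
        (stub_partZ_stiff_differentiable K ε₂ L M).differentiableOn
      have h2' : DifferentiableOn ℂ (fun a : ℂ => (lam a) ^ M) (ball a₀ ρ) := hlam.pow M
      have h3 := h1.div h2' (fun a ha => pow_ne_zero M (hlam0 a ha))
      refine h3.congr ?_
      intro a _
      exact hfM M a
  -- the geometric two-level bound for the normalised family
  have happrox' : ∃ M₁' : ℕ, ∀ M : ℕ, M₁' ≤ M → ∀ a ∈ ball a₀ ρ, ‖f M a - 1 - (u a) ^ M‖ ≤ C * q ^ M := by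
    refine ⟨max M₁ 1, fun M hM a ha => ?_⟩
    have hM0 : M ≠ 0 := by
      have : 1 ≤ M := le_trans (le_max_right _ _) hM
      omega
    haveI : NeZero M := ⟨hM0⟩
    rw [hfM]
    exact happrox M (le_trans (le_max_left _ _) hM) inferInstance a ha
  obtain ⟨M₀, hM₀⟩ :=
    stub_holomorphicTwoLevelZeroLemma u f a₀ ρ C q hρ hq0 hq1 hu hnorm hnc hdiff happrox'
  -- pick `M ≥ max M₀ L`, `M ≥ 1`
  set M : ℕ := max (max M₀ L) 1 with hMdef
  have hM1 : 1 ≤ M := le_max_right _ _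
  have hM0' : M ≠ 0 := by omega
  haveI hMne : NeZero M := ⟨hM0'⟩
  obtain ⟨a, ha, hzero⟩ := hM₀ M (le_trans (le_max_left _ _) (le_max_left _ _))
  rw [hfM] at hzero
  have hZ : partZ K (spatialTab + a • temporalCosTab + (Complex.I * ε₂) • temporalSinTab) L M = 0 := by
    rcases div_eq_zero_iff.mp hzero with h | h
    · exact h
    · exact absurd (pow_eq_zero_iff hM0' |>.mp h) (hlam0 a ha)
  have ha' : ‖a - 1‖ ≤ 1/4 := by
    have : a ∈ closedBall (1 : ℂ) (1/4) := hdisc (ball_subset_closedBall ha)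
    simpa [mem_closedBall, dist_eq_norm] using this
  exact ⟨K, hK, a, ε₂, ha', hε₂, L, M, hL, hMne, hL₀, le_trans (le_max_right _ _) (le_max_left _ _), hZ⟩

/-- NEGATIVE LEMMA MODULO H (line theta-rotor-equimodular-zeros closed modulo its spectral heart): the holomorphic two-level
structure refutes the crux `BalabanIR.BirComplexStableXY` (stmt-HubbardSuperconductivity-2080) — instantiate the crux at
`r = 2`, `B = 128`, `c₀ = 1/24`, feed the admissible stiffness table (`stub_stiffTab_admissible`) at a zero of `Z`
(`stiffZeroExists_of_stiffTwoLevelStructure`), contradict `Z ≠ 0`. -/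
theorem BirComplexStableXY_false_of_StiffTwoLevelStructure :
    StiffTwoLevelStructure →
      ¬ Summit.HubbardSuperconductivity.HubbardSuperconductivity.Theses.BalabanIR.BirComplexStableXY := by
  intro h2 h
  obtain ⟨K₀, L₀, hK⟩ := h 2 128 (1/24) le_rfl (by norm_num)
  obtain ⟨K, hKK, a, ε₂, ha, hε₂, L, M, _, _, hL, hLM, hZ⟩ := stiffZeroExists_of_stiffTwoLevelStructure h2 K₀ L₀
  obtain ⟨hU1, hN, hA, hC⟩ := stub_stiffTab_admissible a ε₂ ha hε₂
  have key := hK K hKK (spatialTab + a • temporalCosTab + (Complex.I * ε₂) • temporalSinTab) hU1 hN hA hC L M hL hLM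
  dsimp only at key
  dsimp only [partZ, action, genF, sh, cube] at hZ
  exact key.1 hZ

end

end Summit.HubbardSuperconductivity.BirComplexStableXYNegative
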